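import Literature.AnabelianGeometry.EtaleTheta.BiKummerOfModelCanonical
import Literature.AnabelianGeometry.EtaleTheta.FrdIVocabularyWeak
import Literature.AlgebraicGeometry.Frobenioids.PerfFactorialWeakCoprime

/-!
# [EtTh] Prop 4.2 (ii) AS PRINTED — the «if and only if»: sufficiency for left fraction-pairs and the
# full equivalence, abstractly and at the model instances of the §4 setting

Mochizuki, *The étale theta function …*, Publ. RIMS **45** (2009), §4, Prop. 4.2 (ii), PDF p.88
(printed 314) [cite: MochizukiEtTh2009, Prop 4.2 p.88]: "A pair of morphisms `t', t'' : C → B` of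
`C` is a left fraction-pair for `f|_B` if and only if there exists a [necessarily unique] isomorphism
`v : C ⥲ A` such that `t' = s' ∘ v`, `t'' = s'' ∘ v`."  Proof p.89: "entirely similar" to (i), whose
sufficiency is "immediate".  abc-iut cell, layer L2, node `EtTh:Prop4.2(ii)` (W6 seat abc-iut-w6-d037);
PROOF-ONLY companion of `BiKummerRoots.lean` (abc-iut-L2-t3), `Discharge/Sec4FractionPairs.lean` /
`Discharge/Sec4Prop42.lean` / `Discharge/Sec4Model.lean` (abc-iut-L6-t12) and
`BiKummerOfModelCanonical.lean` (abc-iut-L2-t9).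

WHAT WAS MISSING.  The typed node `BiKummerSetting.Prop42_ii` renders the "only if" half (necessity
and uniqueness; kernel: `FractionPair.existsUnique_iso_left`, `prop42_ii_of`, `prop42_ii_mkOfModel…`);
for (i) both halves are in the tree (`FractionPair.exists_comp_iso`, `prop42_i_of` is an `↔`), for (ii)
the "if" half — sub-DAG row `EtTh:Prop4.2(ii)/A1 Sufficiency`: "`(s' ∘ v, s'' ∘ v)` is again a left
fraction-pair for `f|_B` (`v` iso)", p.89 «immediate» — had no kernel witness.  Here, in Def. 4.1 (i)'s
reading "a left fraction-pair for `f|_B`" = a fraction-pair `(t', t'') : C → B` (for the element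
`g := t' · (t'')⁻¹ ∈ O^×(C^birat)` it determines) whose restriction `g|_B` is `f|_B` — exactly the
hypothesis shape of the typed `Prop42_ii`:

* `FractionPair.exists_iso_comp_left` — SUFFICIENCY over the abstract §4 setting, from the [FrdI]
  Thm. 5.2 (ii) dictionary laws of `Sec4FractionPairs.lean` (`toB` injective, computing fractions,
  compatible with restriction) + `Φ` divisorial, `B` group-like + transport of disjoint supports along
  base-isomorphisms (`hDSι`, [FrdI] Prop. 4.1 (iii)); the witness is `g := (s' ∘ v) · (s'' ∘ v)⁻¹`,
  with `toB g = Base(v)^* toB f` by the unit bookkeeping `u_{s ∘ v} = Base(v)^* u_s · u_v`;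
* `prop42_ii_iff_of` — the printed «iff» over the abstract setting (same hypotheses as `prop42_ii_of`
  plus `toB` injective);
* `prop42_ii_iff_mkOfModel` (dictionary = identity; hypotheses `Φ` divisorial + the two laws of the
  abstract `DS`), `prop42_ii_iff_mkOfModelCanonical_of_weak` (`DS` := the Prop. 4.1 (iii) predicate, its
  laws THEOREMS from WEAK perf-factoriality, `Frobenioids/PerfFactorialWeakCoprime.lean`), and
  HYPOTHESIS-FREE `prop42_ii_iff_mkOfModelCanonical_treeVocab` / `…_treeVocabWeak` over the two
  canonical vocabularies (`FrdIVocabulary(Weak).lean`; F-L2d2-1).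

Theorems only (DEFS-FREEZE).  HONEST FRAMING: [EtTh] is a refereed pre-IUT paper; nothing here asserts
that such data exist for an actual curve; nothing here bears on [IUTchIII] Cor. 3.12.
-/

noncomputable section

namespace Literature.AnabelianGeometry.EtaleTheta

open CategoryTheory Opposite Literature.AlgebraicGeometry.Frobenioids

universe u₀ v₀ u v w

variable {K : Type u₀} [Field K]

namespace BiKummerSetting

section Abstract

variable {X : SemiGraphs.TemperedArithmeticGroup.{u₀} K} {D₀ : Type u₀} [Category.{v₀} D₀]
  {V : FrdIMonoidStub.{w}} {T : RealifiedDivisorMonoids (D₀ := D₀) V} {D : Type u} [Category.{v} D]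
  {VD : FrdICatStub.{u, v, w} D} {S : BiKummerSetting X T D VD}

namespace FractionPair

/-! ### Proposition 4.2 (ii), sufficiency: pre-composing a fraction-pair with an isomorphism -/

/-- **Prop. 4.2 (ii), sufficiency** (p.89, "immediate" as for (i)): if `(s', s'') : A → B` is a
fraction-pair for `f`, then for every isomorphism `v : C ⥲ A` the pair `(s' ∘ v, s'' ∘ v) : C → B` is a
left fraction-pair for `f|_B` — a fraction-pair (pre-steps, base-equivalent, disjoint supports since
`Div(s ∘ v) = Base(v)^* Div(s)`) for `g := (s' ∘ v) · (s'' ∘ v)⁻¹ ∈ O^×(C^birat)` with `g|_B = f|_B`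
(through the dictionary: `toB g = Base(v)^* toB f`, and both restrictions pull back to it along the
base-isomorphism `Base(s' ∘ v)`). [cite: MochizukiEtTh2009, Prop 4.2(ii) p.88] -/
theorem exists_iso_comp_left
    (hΦd : Objectwise (fun M _ => IsDivisorial M) S.tf.divisorMonoid)
    (hBg : Objectwise (fun M _ => IsGroupLike M) S.tf.ratFnFunctor)
    (toB : ∀ A : S.C, S.biratUnits A →* (S.tf.ratFnFunctor.obj (op A.base))ˣ)
    (htoB : ∀ A : S.C, Function.Injective (toB A))
    (hfrac : ∀ {A B : S.C} (s' s'' : A ⟶ B) (h' : S.IsPreStep s') (h'' : S.IsPreStep s'')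
      (hb : PreFrobenioid.BaseEquivalent S.F s' s''),
      (toB A (S.fracOf s' s'' h' h'' hb) : S.tf.ratFnFunctor.obj (op A.base)) *
        ModelFrobenioid.unit s'' = ModelFrobenioid.unit s')
    (hres : ∀ {A B : S.C} (s : A ⟶ B) (hs : S.IsPreStep s) (x : S.biratUnits A),
      pull S.tf.ratFnFunctor (ModelFrobenioid.baseMap s)
        (toB B (S.restrictAlong s hs x) : S.tf.ratFnFunctor.obj (op B.base)) =
        (toB A x : S.tf.ratFnFunctor.obj (op A.base)))
    (hDSι : ∀ {A A' : D} (e : A' ⟶ A) [IsIso e] {a b : S.tf.Φ.carrier (op A)},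
      S.DisjointSupports a b →
        S.DisjointSupports (pull S.tf.divisorMonoid e a) (pull S.tf.divisorMonoid e b))
    {A B C : S.C} {f : S.biratUnits A} (P : S.FractionPair f B) (v : C ≅ A) :
    ∃ (g : S.biratUnits C) (Q : S.FractionPair g B),
      Q.num = v.hom ≫ P.num ∧ Q.den = v.hom ≫ P.den ∧ Q.restrict = P.restrict := by
  haveI : IsCancelMul (S.tf.ratFnFunctor.obj (op C.base)) :=
    isIntegral_iff_isCancelMul.mp (hBg C.base).isPreDivisorial.isIntegral
  haveI : IsIso (ModelFrobenioid.baseMap P.num) := P.isPreStep_num.2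
  haveI : IsIso (ModelFrobenioid.baseMap v.hom) := ModelFrobenioid.isIso_baseMap_of_isIso v.hom
  have h1 : S.IsPreStep (v.hom ≫ P.num) := ModelFrobenioid.isPreStep_comp_of_isIso' v.hom P.isPreStep_num
  have h2 : S.IsPreStep (v.hom ≫ P.den) := ModelFrobenioid.isPreStep_comp_of_isIso' v.hom P.isPreStep_den
  have hbP : ModelFrobenioid.baseMap P.num = ModelFrobenioid.baseMap P.den := P.base_eq
  have h3 : PreFrobenioid.BaseEquivalent S.F (v.hom ≫ P.num) (v.hom ≫ P.den) := by
    change ModelFrobenioid.baseMap (v.hom ≫ P.num) = ModelFrobenioid.baseMap (v.hom ≫ P.den)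
    rw [ModelFrobenioid.baseMap_comp, ModelFrobenioid.baseMap_comp, hbP]
  haveI : IsIso (ModelFrobenioid.baseMap (v.hom ≫ P.num)) := h1.2
  -- the fraction `g := (s' ∘ v) · (s'' ∘ v)⁻¹` and its dictionary value `Base(v)^* toB f`
  have hxP := hfrac P.num P.den P.isPreStep_num P.isPreStep_den P.base_eq
  rw [P.frac_eq] at hxP
  have hxQ := hfrac (v.hom ≫ P.num) (v.hom ≫ P.den) h1 h2 h3
  have hd1 : ModelFrobenioid.degFr P.den = 1 := P.isPreStep_den.1
  have hn1 : ModelFrobenioid.degFr P.num = 1 := P.isPreStep_num.1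
  have hg : (toB C (S.fracOf (v.hom ≫ P.num) (v.hom ≫ P.den) h1 h2 h3) :
        S.tf.ratFnFunctor.obj (op C.base)) =
      pull S.tf.ratFnFunctor (ModelFrobenioid.baseMap v.hom)
        (toB A f : S.tf.ratFnFunctor.obj (op A.base)) := by
    rw [ModelFrobenioid.unit_comp_pull v.hom P.den, ModelFrobenioid.unit_comp_pull v.hom P.num, hd1, hn1,
      ← hxP, map_mul] at hxQ
    simp only [PNat.one_coe, pow_one] at hxQ
    have key : (toB C (S.fracOf (v.hom ≫ P.num) (v.hom ≫ P.den) h1 h2 h3) :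
          S.tf.ratFnFunctor.obj (op C.base)) *
        (pull S.tf.ratFnFunctor (ModelFrobenioid.baseMap v.hom) (ModelFrobenioid.unit P.den) *
          ModelFrobenioid.unit v.hom) =
        pull S.tf.ratFnFunctor (ModelFrobenioid.baseMap v.hom)
            (toB A f : S.tf.ratFnFunctor.obj (op A.base)) *
          (pull S.tf.ratFnFunctor (ModelFrobenioid.baseMap v.hom) (ModelFrobenioid.unit P.den) *
            ModelFrobenioid.unit v.hom) := by
      rw [hxQ, mul_assoc]
    exact mul_right_cancel key
  -- `g|_B = f|_B`: both pull back to `Base(v)^* toB f` along the base-isomorphism `Base(s' ∘ v)`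
  have hrP : pull S.tf.ratFnFunctor (ModelFrobenioid.baseMap P.num)
      (toB B P.restrict : S.tf.ratFnFunctor.obj (op B.base)) = (toB A f : _) :=
    hres P.num P.isPreStep_num f
  have hrQ := hres (v.hom ≫ P.num) h1 (S.fracOf (v.hom ≫ P.num) (v.hom ≫ P.den) h1 h2 h3)
  have hQP : S.restrictAlong (v.hom ≫ P.num) h1 (S.fracOf (v.hom ≫ P.num) (v.hom ≫ P.den) h1 h2 h3) =
      P.restrict := by
    apply htoB B
    apply Units.ext
    apply PreFrobenioid.pull_injective (ModelFrobenioid.baseMap (v.hom ≫ P.num))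
    rw [hrQ, hg, ← hrP, ← pull_comp, ← ModelFrobenioid.baseMap_comp]
  refine ⟨S.fracOf (v.hom ≫ P.num) (v.hom ≫ P.den) h1 h2 h3,
    ⟨v.hom ≫ P.num, v.hom ≫ P.den, h1, h2, h3, rfl, ?_⟩, rfl, rfl, hQP⟩
  change S.DisjointSupports (ModelFrobenioid.div (v.hom ≫ P.num)) (ModelFrobenioid.div (v.hom ≫ P.den))
  rw [ModelFrobenioid.div_comp_of_isIso' hΦd, ModelFrobenioid.div_comp_of_isIso' hΦd]
  exact hDSι (ModelFrobenioid.baseMap v.hom) P.disjointSupports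

end FractionPair

/-! ### Proposition 4.2 (ii), the printed «if and only if», over the abstract setting -/

variable (S) in
/-- **[EtTh] Prop. 4.2 (ii) AS PRINTED (both directions) over the abstract §4 setting**: for a
fraction-pair `(s', s'') : A → B` for `f` and morphisms `t', t'' : C → B`, "`(t', t'')` is a left
fraction-pair for `f|_B`" — a fraction-pair for some `g ∈ O^×(C^birat)` with `g|_B = f|_B` — "if and only
if there exists a [necessarily unique] isomorphism `v : C ⥲ A` such that `t' = s' ∘ v`, `t'' = s'' ∘ v`";
hypotheses = those of `prop42_ii_of` ([FrdI] Thm. 5.2 (ii) dictionary + Prop. 4.1 (iii) support laws) plus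
injectivity of the dictionary (as in `prop42_i_of`). [cite: MochizukiEtTh2009, Prop 4.2(ii) p.88] -/
theorem prop42_ii_iff_of
    (hΦd : Objectwise (fun M _ => IsDivisorial M) S.tf.divisorMonoid)
    (hBg : Objectwise (fun M _ => IsGroupLike M) S.tf.ratFnFunctor)
    (toB : ∀ A : S.C, S.biratUnits A →* (S.tf.ratFnFunctor.obj (op A.base))ˣ)
    (htoB : ∀ A : S.C, Function.Injective (toB A))
    (hfrac : ∀ {A B : S.C} (s' s'' : A ⟶ B) (h' : S.IsPreStep s') (h'' : S.IsPreStep s'')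
      (hb : PreFrobenioid.BaseEquivalent S.F s' s''),
      (toB A (S.fracOf s' s'' h' h'' hb) : S.tf.ratFnFunctor.obj (op A.base)) *
        ModelFrobenioid.unit s'' = ModelFrobenioid.unit s')
    (hres : ∀ {A B : S.C} (s : A ⟶ B) (hs : S.IsPreStep s) (x : S.biratUnits A),
      pull S.tf.ratFnFunctor (ModelFrobenioid.baseMap s)
        (toB B (S.restrictAlong s hs x) : S.tf.ratFnFunctor.obj (op B.base)) =
        (toB A x : S.tf.ratFnFunctor.obj (op A.base)))
    (hDS : ∀ {A : Dᵒᵖ} {a b a' b' : S.tf.Φ.carrier A}, S.DisjointSupports a b →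
      S.DisjointSupports a' b' → a * b' = a' * b → a = a' ∧ b = b')
    (hDSι : ∀ {A A' : D} (e : A' ⟶ A) [IsIso e] {a b : S.tf.Φ.carrier (op A)},
      S.DisjointSupports a b →
        S.DisjointSupports (pull S.tf.divisorMonoid e a) (pull S.tf.divisorMonoid e b))
    {A B C : S.C} (f : S.biratUnits A) (P : S.FractionPair f B) (t' t'' : C ⟶ B) :
    (∃ (g : S.biratUnits C) (Q : S.FractionPair g B), Q.num = t' ∧ Q.den = t'' ∧ Q.restrict = P.restrict) ↔
      ∃! v : C ≅ A, v.hom ≫ P.num = t' ∧ v.hom ≫ P.den = t'' := by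
  constructor
  · rintro ⟨g, Q, rfl, rfl, hQP⟩
    exact FractionPair.existsUnique_iso_left hΦd hBg toB hfrac hres hDS hDSι P Q hQP
  · rintro ⟨v, ⟨h₁, h₂⟩, -⟩
    obtain ⟨g, Q, hQn, hQd, hQr⟩ :=
      FractionPair.exists_iso_comp_left hΦd hBg toB htoB hfrac hres hDSι P v
    exact ⟨g, Q, hQn.trans h₁, hQd.trans h₂, hQr⟩

end Abstract

/-! ### At the model instances (`toB = id`) -/

section Model

variable (X : SemiGraphs.TemperedArithmeticGroup.{u₀} K) {D₀ : Type u₀} [Category.{v₀} D₀]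
  {V : FrdIMonoidStub.{w}} {T : RealifiedDivisorMonoids (D₀ := D₀) V} {D : Type u} [Category.{v} D]
  {VD : FrdICatStub.{u, v, w} D}
  (tf : TemperedFrobenioid T D VD) (hZ : tf.monoidType = MonoidType.Z)
  (hP : ∀ A : Dᵒᵖ, IsPerfect (tf.Φ.carrier A)) (hBΛ : ∀ (Y : D₀ᵒᵖ) (b : T.BΛ.obj Y), IsUnit b)
  (DS : ∀ {A : Dᵒᵖ}, tf.Φ.carrier A → tf.Φ.carrier A → Prop) (IG : D → Prop)
  (gS : ∀ A : D, IG A → (X.Pi →* Aut A)) (gSs : ∀ (A : D) (h : IG A), Function.Surjective (gS A h))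
  (NH : Subgroup (Field.absoluteGaloisGroup K) → tf.category → ℕ+ → Prop)
  (AB : ∀ {A B : tf.category}, Subgroup (Aut A) → (A ⟶ A) → (A ⟶ B) → Prop) (A₀ : tf.category)
  (hA₀ : PreFrobenioid.IsFrobeniusTrivial tf.toElem A₀) (hA₀' : IG A₀.base)

/-- **[EtTh] Prop. 4.2 (ii) AS PRINTED («iff») for the model instance `mkOfModel`** (dictionary =
identity, [FrdI] Thm. 5.2 (ii)): given `Φ` divisorial and the cancellation / transport laws of the abstract
disjoint-supports predicate `DS` ([FrdI] Prop. 4.1 (iii)). [cite: MochizukiEtTh2009, Prop 4.2(ii) p.88] -/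
theorem prop42_ii_iff_mkOfModel
    (hΦd : Objectwise (fun M _ => IsDivisorial M) tf.divisorMonoid)
    (hDS : ∀ {A : Dᵒᵖ} {a b a' b' : tf.Φ.carrier A}, DS a b → DS a' b' → a * b' = a' * b →
      a = a' ∧ b = b')
    (hDSι : ∀ {A A' : D} (e : A' ⟶ A) [IsIso e] {a b : tf.Φ.carrier (op A)}, DS a b →
      DS (pull tf.divisorMonoid e a) (pull tf.divisorMonoid e b))
    {A B C : (mkOfModel X tf hZ hP hBΛ DS IG gS gSs NH AB A₀ hA₀ hA₀').C}
    (f : (mkOfModel X tf hZ hP hBΛ DS IG gS gSs NH AB A₀ hA₀ hA₀').biratUnits A)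
    (P : (mkOfModel X tf hZ hP hBΛ DS IG gS gSs NH AB A₀ hA₀ hA₀').FractionPair f B) (t' t'' : C ⟶ B) :
    (∃ (g : (mkOfModel X tf hZ hP hBΛ DS IG gS gSs NH AB A₀ hA₀ hA₀').biratUnits C)
        (Q : (mkOfModel X tf hZ hP hBΛ DS IG gS gSs NH AB A₀ hA₀ hA₀').FractionPair g B),
        Q.num = t' ∧ Q.den = t'' ∧ Q.restrict = P.restrict) ↔
      ∃! v : C ≅ A, v.hom ≫ P.num = t' ∧ v.hom ≫ P.den = t'' := by
  refine prop42_ii_iff_of _ hΦd (tf.isGroupLike_ratFnFunctor hBΛ) (fun A => MonoidHom.id (tf.biratUnitsModel A))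
    (fun _ _ _ h => h) ?_ ?_ hDS hDSι f P t' t''
  · intro A B s' s'' h' h'' hb
    exact coe_fracOfModel_mul_unit tf hBΛ s' s''
  · intro A B s hs x
    exact pull_coe_restrictAlongModel tf s hs x

/-- **[EtTh] Prop. 4.2 (ii) AS PRINTED («iff») for the canonical model instance, from WEAK
perf-factoriality** (`DS` := the [FrdI] Prop. 4.1 (iii) predicate; its two laws are theorems —
`IsPerfFactorialWeak.eq_of_mul_eq_mul_of_forall_common_dvd_eq_one`, `ds_pull_of_isIso`).
[cite: MochizukiEtTh2009, Prop 4.2(ii) p.88] -/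
theorem prop42_ii_iff_mkOfModelCanonical_of_weak (hpf : ∀ A : Dᵒᵖ, IsPerfFactorialWeak (tf.Φ.carrier A))
    {A B C : (mkOfModelCanonical X tf hZ hP IG gS gSs NH A₀ hA₀ hA₀').C}
    (f : (mkOfModelCanonical X tf hZ hP IG gS gSs NH A₀ hA₀ hA₀').biratUnits A)
    (P : (mkOfModelCanonical X tf hZ hP IG gS gSs NH A₀ hA₀ hA₀').FractionPair f B) (t' t'' : C ⟶ B) :
    (∃ (g : (mkOfModelCanonical X tf hZ hP IG gS gSs NH A₀ hA₀ hA₀').biratUnits C)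
        (Q : (mkOfModelCanonical X tf hZ hP IG gS gSs NH A₀ hA₀ hA₀').FractionPair g B),
        Q.num = t' ∧ Q.den = t'' ∧ Q.restrict = P.restrict) ↔
      ∃! v : C ≅ A, v.hom ≫ P.num = t' ∧ v.hom ≫ P.den = t'' :=
  prop42_ii_iff_mkOfModel X tf hZ hP T.isUnit_BΛ _ IG gS gSs NH _ A₀ hA₀ hA₀'
    (fun A => (hpf (op A)).isDivisorial)
    (fun hab hab' e => (hpf _).eq_of_mul_eq_mul_of_forall_common_dvd_eq_one (hP _) hab hab' e)
    (fun e _ _ _ hab => ds_pull_of_isIso tf e hab) f P t' t''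

/-- The strong hypothesis `∀ A, IsPerfFactorial (Φ(A))` (the binder of abc-iut-L2-t9's
`prop42_ii_mkOfModelCanonical`) is a special case (`IsPerfFactorial.weak`).
[cite: MochizukiEtTh2009, Prop 4.2(ii) p.88] -/
theorem prop42_ii_iff_mkOfModelCanonical (hpf : ∀ A : Dᵒᵖ, IsPerfFactorial (tf.Φ.carrier A))
    {A B C : (mkOfModelCanonical X tf hZ hP IG gS gSs NH A₀ hA₀ hA₀').C}
    (f : (mkOfModelCanonical X tf hZ hP IG gS gSs NH A₀ hA₀ hA₀').biratUnits A)
    (P : (mkOfModelCanonical X tf hZ hP IG gS gSs NH A₀ hA₀ hA₀').FractionPair f B) (t' t'' : C ⟶ B) :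
    (∃ (g : (mkOfModelCanonical X tf hZ hP IG gS gSs NH A₀ hA₀ hA₀').biratUnits C)
        (Q : (mkOfModelCanonical X tf hZ hP IG gS gSs NH A₀ hA₀ hA₀').FractionPair g B),
        Q.num = t' ∧ Q.den = t'' ∧ Q.restrict = P.restrict) ↔
      ∃! v : C ≅ A, v.hom ≫ P.num = t' ∧ v.hom ≫ P.den = t'' :=
  prop42_ii_iff_mkOfModelCanonical_of_weak X tf hZ hP IG gS gSs NH A₀ hA₀ hA₀' (fun A => (hpf A).weak)
    f P t' t''

end Model

/-! ### Hypothesis-free at the canonical vocabularies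

The vocabulary is named explicitly in the two statements below (`biratUnits (V := treeMonoidVocab…) …`) so
that they read — and hash — differently from each other and from the abstract-vocabulary forms above. -/

section TreeVocab

variable (X : SemiGraphs.TemperedArithmeticGroup.{u₀} K) {D₀ : Type u₀} [Category.{v₀} D₀]
  {T : RealifiedDivisorMonoids (D₀ := D₀) treeMonoidVocab.{w}} {D : Type u} [Category.{v} D]
  {VD : FrdICatStub.{u, v, w} D} (tf : TemperedFrobenioid T D VD) (hZ : tf.monoidType = MonoidType.Z)
  (hP : ∀ A : Dᵒᵖ, IsPerfect (tf.Φ.carrier A)) (IG : D → Prop) (gS : ∀ A : D, IG A → (X.Pi →* Aut A))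
  (gSs : ∀ (A : D) (h : IG A), Function.Surjective (gS A h))
  (NH : Subgroup (Field.absoluteGaloisGroup K) → tf.category → ℕ+ → Prop) (A₀ : tf.category)
  (hA₀ : PreFrobenioid.IsFrobeniusTrivial tf.toElem A₀) (hA₀' : IG A₀.base)

/-- **[EtTh] Prop. 4.2 (ii) AS PRINTED («iff»), OUTRIGHT for the canonical model instance over
`treeMonoidVocab`** (the perf-factoriality input is the Def. 3.6 (ii) field `TemperedFrobenioid.isPerfFactorial`).
[cite: MochizukiEtTh2009, Prop 4.2(ii) p.88] -/
theorem prop42_ii_iff_mkOfModelCanonical_treeVocab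
    {A B C : (mkOfModelCanonical X tf hZ hP IG gS gSs NH A₀ hA₀ hA₀').C}
    (f : (mkOfModelCanonical X tf hZ hP IG gS gSs NH A₀ hA₀ hA₀').biratUnits A)
    (P : (mkOfModelCanonical X tf hZ hP IG gS gSs NH A₀ hA₀ hA₀').FractionPair f B) (t' t'' : C ⟶ B) :
    (∃ (g : biratUnits (V := treeMonoidVocab) (mkOfModelCanonical X tf hZ hP IG gS gSs NH A₀ hA₀ hA₀') C)
        (Q : (mkOfModelCanonical X tf hZ hP IG gS gSs NH A₀ hA₀ hA₀').FractionPair g B),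
        Q.num = t' ∧ Q.den = t'' ∧ Q.restrict = P.restrict) ↔
      ∃! v : C ≅ A, v.hom ≫ P.num = t' ∧ v.hom ≫ P.den = t'' :=
  prop42_ii_iff_mkOfModelCanonical X tf hZ hP IG gS gSs NH A₀ hA₀ hA₀' tf.isPerfFactorial f P t' t''

end TreeVocab

section TreeVocabWeak

variable (X : SemiGraphs.TemperedArithmeticGroup.{u₀} K) {D₀ : Type u₀} [Category.{v₀} D₀]
  {T : RealifiedDivisorMonoids (D₀ := D₀) treeMonoidVocabWeak.{w}} {D : Type u} [Category.{v} D]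
  {VD : FrdICatStub.{u, v, w} D} (tf : TemperedFrobenioid T D VD) (hZ : tf.monoidType = MonoidType.Z)
  (hP : ∀ A : Dᵒᵖ, IsPerfect (tf.Φ.carrier A)) (IG : D → Prop) (gS : ∀ A : D, IG A → (X.Pi →* Aut A))
  (gSs : ∀ (A : D) (h : IG A), Function.Surjective (gS A h))
  (NH : Subgroup (Field.absoluteGaloisGroup K) → tf.category → ℕ+ → Prop) (A₀ : tf.category)
  (hA₀ : PreFrobenioid.IsFrobeniusTrivial tf.toElem A₀) (hA₀' : IG A₀.base)

/-- **[EtTh] Prop. 4.2 (ii) AS PRINTED («iff»), OUTRIGHT for the canonical model instance over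
`treeMonoidVocabWeak`** — the vocabulary of record at tempered coverings with infinitely many special-fibre
components (`Ÿ`, `Z_∞`; F-L2d2-1): the Def. 3.6 (ii) field reads `IsPerfFactorialCof`, whence weakly
perf-factorial. [cite: MochizukiEtTh2009, Prop 4.2(ii) p.88] -/
theorem prop42_ii_iff_mkOfModelCanonical_treeVocabWeak
    {A B C : (mkOfModelCanonical X tf hZ hP IG gS gSs NH A₀ hA₀ hA₀').C}
    (f : (mkOfModelCanonical X tf hZ hP IG gS gSs NH A₀ hA₀ hA₀').biratUnits A)
    (P : (mkOfModelCanonical X tf hZ hP IG gS gSs NH A₀ hA₀ hA₀').FractionPair f B) (t' t'' : C ⟶ B) :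
    (∃ (g : biratUnits (V := treeMonoidVocabWeak) (mkOfModelCanonical X tf hZ hP IG gS gSs NH A₀ hA₀ hA₀') C)
        (Q : (mkOfModelCanonical X tf hZ hP IG gS gSs NH A₀ hA₀ hA₀').FractionPair g B),
        Q.num = t' ∧ Q.den = t'' ∧ Q.restrict = P.restrict) ↔
      ∃! v : C ≅ A, v.hom ≫ P.num = t' ∧ v.hom ≫ P.den = t'' :=
  prop42_ii_iff_mkOfModelCanonical_of_weak X tf hZ hP IG gS gSs NH A₀ hA₀ hA₀'
    (fun A => (tf.isPerfFactorial A).elim fun h _ => h) f P t' t''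

end TreeVocabWeak

end BiKummerSetting

end Literature.AnabelianGeometry.EtaleTheta

end
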